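import Literature.Computability.AlgebraicComplexity.BorderApolarityPerturb
import Literature.Computability.AlgebraicComplexity.BorderRankMatMul223Weights
import Literature.Computability.AlgebraicComplexity.BorderRankMatMul223CertSound
import Literature.Computability.AlgebraicComplexity.BorderRankMatMulSmall223Proofs
import HarnessLib

/-!
# `R̲(⟨2,2,3⟩) = 10` (Conner–Harper–Landsberg 2023, Thm. 1.3) — proved (torus-fixed border apolarity)

Topic `Literature/Computability/AlgebraicComplexity`.  The lower bound of Conner–Harper–Landsberg
2023, Thm. 1.3, "`R̲(M_⟨223⟩) = 10`" ("Previous to this paper `M_⟨2⟩` was the only nontrivial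
matrix multiplication tensor whose border rank had been determined"; §7.2, by border apolarity:
"There are eight `𝔹`-fixed `3`-planes in `U* ⊗ 𝔰𝔩(V) ⊗ W` … The only one passing the (210)-test is
… But for the (120)-test, the kernel is `7`-dimensional and we conclude"), for the tree's ALGEBRAIC
border rank `algBorderRank` over `K[ε]` (`SchoenhageTau.lean`) and every field `K` of
characteristic `0`:

* `MatMul223.ten_le_algBorderRank_matMulTensor_223 : 10 ≤ algBorderRank (matMulTensor K 2 2 3)`;
* `MatMul223.algBorderRank_matMulTensor_223 : algBorderRank (matMulTensor K 2 2 3) = 10` (with the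
  tree's Bini–Capovani–Romani–Lotti upper bound `BCRL1979_algBorderRank_matMulTensor_223_le`);
* `ConnerHarperLandsberg2023_thm_1_3_holds` — the DISCHARGE of the named fact
  `ConnerHarperLandsberg2023_thm_1_3` (`BorderRankMatMulSmall.lean`) through the tree's reduction
  `ConnerHarperLandsberg2023_thm_1_3_iff_lower` (`BorderRankMatMulSmall223Proofs.lean`).

## The proof (CHL 2023, §2.3–§3 and §7.2, made elementary and torus-only; the tree's `⟨2,2,2⟩`
## argument `MatMulTwo.seven_le_algBorderRank_matMulTensor_two` transplanted)

Suppose `R̲(⟨2,2,3⟩) ≤ 9`; with the tree's `9 ≤ R̲` (Koszul flattening,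
`nine_le_algBorderRank_matMulTensor_223`) there is an order-`h` approximate decomposition with exactly
`9` triads `(u_ρ, v_ρ, w_ρ)` over `K[ε]` (slots: `u` = output `C = K^{2×3}`, `v` = `A = K^{2×2}`,
`w` = `B = K^{2×3}`).  Perturb `v, w` by `εᴺ e` at nine distinct coordinate pairs
(`BorderApolarityPerturb.lean`): still a decomposition, with the nine points `(v_ρ, w_ρ)` in general
position for the `(2,1)`- and `(1,2)`-forms over `L = K(ε)`.  Let `F = lim_{ε→0} I₁₁₀ ≤ K^{A* ⊗ B*}`
(`BorderApolarityLimits.lean`).  Then (CHL §2.3 (i)–(iii)) `dim F ≥ 24 − 9 = 15`,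
`F ≤ M_⟨223⟩(C*)^⊥`, `dim (F · A*) ≤ dim I₂₁₀ ≤ dim S²A* ⊗ B* − 9 = 51` and
`dim (F · B*) ≤ dim A* ⊗ S²B* − 9 = 75`.  Degenerate along the one-parameter subgroup with weights
`deg((i,j),(j',k)) = 9i − 3j + 3j' + k` (`GradedInitialSubspace.lean`, `BorderRankMatMul223Weights.lean`):
the initial subspace `in(F)` has `dim ≥ 15`, lies in `M_⟨223⟩(C*)^⊥` degree by degree — whose graded
pieces are the `18` weight LINES `K ω_k` of `U* ⊗ 𝔰𝔩(V) ⊗ W` — hence contains `≥ 15` of the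
`ω_k`, and `in(F) · A* ≤ in(F · A*)` has `dim ≤ 51` (likewise `≤ 75` for `B*`).  But by the
kernel-checked certificate `MatMul223.rank_test_ge` (`BorderRankMatMul223CertSound.lean`) any `15`
of the `ω_k` have `(210)`-products spanning dimension `≥ 52` or `(120)`-products spanning `≥ 76`.

## References

* A. Conner, A. Harper, J. M. Landsberg, *New lower bounds for matrix multiplication and `det₃`*,
  Forum Math. Pi 11 (2023) e17 = arXiv:1911.07981, Thm. 1.3, §2.3–§2.5, §3, §4, §7.2.
  [ConnerHarperLandsberg2023]
* D. Bini, M. Capovani, F. Romani, G. Lotti, *`O(n^{2.7799})` complexity for `n × n` approximate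
  matrix multiplication*, Inform. Process. Lett. 8 (1979) 234–235 (the upper bound `≤ 10`).
  [BiniCapovaniRomaniLotti1979]

## Design

No Borel fixed point theorem / Lie's theorem and no Hilbert scheme: the torus normal form is the
initial-subspace count of `GradedInitialSubspace.lean`, and unipotent normalisation is replaced by
checking all `816 = C(18,3)` torus-fixed candidates instead of CHL's `8` Borel-fixed ones.
-/

noncomputable section

open scoped BigOperators Polynomial
open Polynomial

namespace Literature.Computability.AlgebraicComplexity

namespace MatMul223

universe u

/-! ## `dim S²A* ⊗ B* ≤ 60`, `dim A* ⊗ S²B* ≤ 84` -/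

section SymBound

variable (L : Type u) [Field L]

/-- The coordinates `(a, a', b)` with `a ≤ a'` number `60 = 10 · 6`.
[cite: ConnerHarperLandsberg2023, §7.2 (dimension count of the (210)-test)] -/
theorem card_ordA : Fintype.card {t : A2 × A2 × B23 // encA t.1 ≤ encA t.2.1} = 60 := by rfl

/-- The coordinates `(a, b, b')` with `b ≤ b'` number `84 = 4 · 21`.
[cite: ConnerHarperLandsberg2023, §7.2 (dimension count of the (120)-test)] -/
theorem card_ordB : Fintype.card {t : A2 × B23 × B23 // encB t.2.1 ≤ encB t.2.2} = 84 := by rfl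

/-- `dim S²A* ⊗ B* ≤ 60` for `⟨2,2,3⟩` (symmetric tensors are determined by their coordinates with
`a ≤ a'`). [cite: ConnerHarperLandsberg2023, §7.2] -/
theorem finrank_symA_le : Module.finrank L (symA L (α := A2) (β := B23)) ≤ 60 := by
  let res : symA L (α := A2) (β := B23) →ₗ[L] ({t : A2 × A2 × B23 // encA t.1 ≤ encA t.2.1} → L) :=
    { toFun := fun γ t => (γ : A2 × A2 × B23 → L) t.1
      map_add' := fun _ _ => rfl
      map_smul' := fun _ _ => rfl }
  have hinj : Function.Injective res := by
    intro γ γ' hγ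
    apply Subtype.ext
    funext ⟨a, a', b⟩
    rcases le_total (encA a) (encA a') with hle | hle
    · exact congr_fun hγ ⟨(a, a', b), hle⟩
    · have h1 : (γ : A2 × A2 × B23 → L) (a', a, b) = (γ' : A2 × A2 × B23 → L) (a', a, b) :=
        congr_fun hγ ⟨(a', a, b), hle⟩
      rw [γ.2 a a' b, γ'.2 a a' b]
      exact h1
  calc Module.finrank L (symA L (α := A2) (β := B23))
      ≤ Module.finrank L ({t : A2 × A2 × B23 // encA t.1 ≤ encA t.2.1} → L) :=
        LinearMap.finrank_le_finrank_of_injective hinj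
    _ = 60 := by rw [Module.finrank_fintype_fun_eq_card, card_ordA]

/-- `dim A* ⊗ S²B* ≤ 84` for `⟨2,2,3⟩`. [cite: ConnerHarperLandsberg2023, §7.2] -/
theorem finrank_symB_le : Module.finrank L (symB L (α := A2) (β := B23)) ≤ 84 := by
  let res : symB L (α := A2) (β := B23) →ₗ[L] ({t : A2 × B23 × B23 // encB t.2.1 ≤ encB t.2.2} → L) :=
    { toFun := fun γ t => (γ : A2 × B23 × B23 → L) t.1
      map_add' := fun _ _ => rfl
      map_smul' := fun _ _ => rfl }
  have hinj : Function.Injective res := by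
    intro γ γ' hγ
    apply Subtype.ext
    funext ⟨a, b, b'⟩
    rcases le_total (encB b) (encB b') with hle | hle
    · exact congr_fun hγ ⟨(a, b, b'), hle⟩
    · have h1 : (γ : A2 × B23 × B23 → L) (a, b', b) = (γ' : A2 × B23 × B23 → L) (a, b', b) :=
        congr_fun hγ ⟨(a, b', b), hle⟩
      rw [γ.2 a b b', γ'.2 a b b']
      exact h1
  calc Module.finrank L (symB L (α := A2) (β := B23))
      ≤ Module.finrank L ({t : A2 × B23 × B23 // encB t.2.1 ≤ encB t.2.2} → L) :=
        LinearMap.finrank_le_finrank_of_injective hinj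
    _ = 84 := by rw [Module.finrank_fintype_fun_eq_card, card_ordB]

end SymBound

/-! ## The theorem -/

section Main

variable (K : Type u) [Field K] [CharZero K]

omit [CharZero K] in
/-- The `(210)` test products are the `(210)` products of the weight vectors.
[cite: ConnerHarperLandsberg2023, §3 (the (210)-map)] -/
theorem rowFunA_eq (k : Fin 18) (a₀ : A2) : rowFunA K k a₀ = MatMulTwo.mul210 K a₀ (wv K k) := by
  funext t; rfl

omit [CharZero K] in
/-- The `(120)` test products are the `(120)` products of the weight vectors.
[cite: ConnerHarperLandsberg2023, §3 (the (120)-map)] -/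
theorem rowFunB_eq (k : Fin 18) (b₀ : B23) : rowFunB K k b₀ = MatMulTwo.mul120 K b₀ (wv K k) := by
  funext t; rfl

/-- **`R̲(⟨2,2,3⟩) ≥ 10` over every field of characteristic `0`** (Conner–Harper–Landsberg 2023,
Thm. 1.3, lower half; here by the torus-fixed border apolarity argument described in the module
docstring, after CHL §7.2), for the algebraic border rank over `K[ε]`.
[cite: ConnerHarperLandsberg2023, Thm. 1.3 and §7.2] -/
theorem ten_le_algBorderRank_matMulTensor_223 : 10 ≤ algBorderRank (matMulTensor K 2 2 3) := by
  classical
  set t := matMulTensor K 2 2 3 with ht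
  by_contra hlt
  push Not at hlt
  have h9 : 9 ≤ algBorderRank t := nine_le_algBorderRank_matMulTensor_223 K
  -- an order-`h` approximate decomposition with exactly `9` triads
  obtain ⟨h, hh⟩ : ∃ h, approxRank h t = algBorderRank t :=
    Nat.sInf_mem (Set.range_nonempty fun h : ℕ => approxRank h t)
  have hr9 : approxRank h t = 9 := by omega
  have hmem : (9 : ℕ) ∈ {r : ℕ | ∃ (u : Fin r → Fin 2 × Fin 3 → K[X]) (v : Fin r → A2 → K[X])
      (w : Fin r → B23 → K[X]), IsApproxDecomposition h t u v w} := by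
    have hm := Nat.sInf_mem (exists_isApproxDecomposition h t)
    change approxRank h t ∈ _ at hm
    rwa [hr9] at hm
  obtain ⟨u, v, w, huvw⟩ := hmem
  -- nine distinct coordinate pairs
  have hr24 : 9 ≤ Fintype.card (A2 × B23) := by
    simp [Fintype.card_prod, Fintype.card_fin]
  set pts : Fin 9 → A2 × B23 := fun ρ => (Fintype.equivFin (A2 × B23)).symm (Fin.castLE hr24 ρ)
    with hpts
  have hinj : Function.Injective fun ρ => ((pts ρ).1, (pts ρ).2) := by
    simp only [Prod.mk.eta]
    exact (Fintype.equivFin (A2 × B23)).symm.injective.comp (Fin.castLE_injective hr24)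
  -- `N` beyond `h` and all degrees
  set N := h + 1 + (∑ ρ, ∑ a, (v ρ a).natDegree + ∑ ρ, ∑ b, (w ρ b).natDegree) with hN_def
  have hNh : h < N := by omega
  have hN0 : 0 < N := by omega
  have hv : ∀ ρ a, (v ρ a).natDegree < N := by
    intro ρ a
    have h1 : (v ρ a).natDegree ≤ ∑ a, (v ρ a).natDegree :=
      Finset.single_le_sum (f := fun a => (v ρ a).natDegree) (fun _ _ => Nat.zero_le _)
        (Finset.mem_univ a)
    have h2 : ∑ a, (v ρ a).natDegree ≤ ∑ ρ, ∑ a, (v ρ a).natDegree :=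
      Finset.single_le_sum (f := fun ρ => ∑ a, (v ρ a).natDegree) (fun _ _ => Nat.zero_le _)
        (Finset.mem_univ ρ)
    omega
  have hw : ∀ ρ b, (w ρ b).natDegree < N := by
    intro ρ b
    have h1 : (w ρ b).natDegree ≤ ∑ b, (w ρ b).natDegree :=
      Finset.single_le_sum (f := fun b => (w ρ b).natDegree) (fun _ _ => Nat.zero_le _)
        (Finset.mem_univ b)
    have h2 : ∑ b, (w ρ b).natDegree ≤ ∑ ρ, ∑ b, (w ρ b).natDegree :=
      Finset.single_le_sum (f := fun ρ => ∑ b, (w ρ b).natDegree) (fun _ _ => Nat.zero_le _)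
        (Finset.mem_univ ρ)
    omega
  -- the perturbed decomposition and its `(110)` limit space `F`
  have hdec := isApproxDecomposition_pert v w (fun ρ => (pts ρ).1) (fun ρ => (pts ρ).2) N huvw hNh
  set x' := pertX v (fun ρ => (pts ρ).1) N with hx'
  set y' := pertY w (fun ρ => (pts ρ).2) N with hy'
  let L := FractionRing K[X]
  set F : Submodule K (A2 × B23 → K) := limSub K L (I11 L x' y') with hF_def
  have hcard : Fintype.card A2 * Fintype.card B23 = 24 := by
    simp [Fintype.card_prod, Fintype.card_fin]
  have hF15 : 15 ≤ Module.finrank K F := by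
    have h1 := finrank_limSub_eq K L (I11 L x' y')
    have h2 := finrank_I11_ge L x' y'
    rw [hcard] at h2
    rw [hF_def, h1]
    omega
  have hFann : F ≤ annSub t := limSub_I11_le_annSub L x' y' hdec
  -- the `(210)` and `(120)` products of `F`
  set G₁ : Submodule K (A2 × A2 × B23 → K) := ⨆ a₀ : A2, F.map (MatMulTwo.mul210 K a₀) with hG₁_def
  set G₂ : Submodule K (A2 × B23 × B23 → K) := ⨆ b₀ : B23, F.map (MatMulTwo.mul120 K b₀)
    with hG₂_def
  have hG₁ : Module.finrank K G₁ ≤ 51 := by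
    have hle : G₁ ≤ limSub K L (I21 L x' y') := iSup_le fun a₀ => map_mul210_limSub_le L x' y' a₀
    have h1 := finrank_limSub_eq K L (I21 L x' y')
    have h2 := finrank_I21_pert_add_le L hinj hv hw hN0
    rw [← hx', ← hy'] at h2
    have h3 := finrank_symA_le L
    have h4 := Submodule.finrank_mono hle
    omega
  have hG₂ : Module.finrank K G₂ ≤ 75 := by
    have hle : G₂ ≤ limSub K L (I12 L x' y') := iSup_le fun b₀ => map_mul120_limSub_le L x' y' b₀
    have h1 := finrank_limSub_eq K L (I12 L x' y')
    have h2 := finrank_I12_pert_add_le L hinj hv hw hN0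
    rw [← hx', ← hy'] at h2
    have h3 := finrank_symB_le L
    have h4 := Submodule.finrank_mono hle
    omega
  -- the torus degeneration of `F` contains `≥ 15` weight vectors
  set S := Finset.univ.filter fun k : Fin 18 => wv K k ∈ inPart deg2 F (wdeg k) with hS_def
  have hS : 15 ≤ S.card := hF15.trans (finrank_le_card_weightLines hFann)
  -- but those fail a test
  rcases rank_test_ge K S hS with h52 | h76
  · set InG : Submodule K (A2 × A2 × B23 → K) :=
      ⨆ i ∈ Finset.range 30, inPart deg3A G₁ (-6 + i) with hInG
    have hspan : Submodule.span K (genSetA K S) ≤ InG := by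
      refine Submodule.span_le.2 ?_
      rintro _ ⟨k, hk, a₀, rfl⟩
      rw [hS_def, Finset.mem_filter] at hk
      rw [rowFunA_eq]
      have h1 : MatMulTwo.mul210 K a₀ (wv K k) ∈ inPart deg3A G₁ (wdeg k + degA a₀) := by
        refine inPart_mono deg3A (le_iSup (fun a₀ : A2 => F.map (MatMulTwo.mul210 K a₀)) a₀) _ ?_
        exact map_inPart_le deg2 deg3A (MatMulTwo.mul210 K a₀) (degA a₀) (mul210_mem_Vge K a₀)
          (projDeg_mul210 K a₀) F (wdeg k) (Submodule.mem_map_of_mem hk.2)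
      have hwin := wdeg_add_degA_window k a₀
      obtain ⟨i, hi, hieq⟩ : ∃ i : ℕ, i ∈ Finset.range 30 ∧ (-6 : ℤ) + i = wdeg k + degA a₀ :=
        ⟨(wdeg k + degA a₀ + 6).toNat, by rw [Finset.mem_range]; omega, by omega⟩
      rw [← hieq] at h1
      exact (le_iSup₂ (f := fun i (_ : i ∈ Finset.range 30) => inPart deg3A G₁ (-6 + i)) i hi) h1
    have hIn := finrank_biSup_inPart_le deg3A G₁ (-6) 30 (fun t => (deg3A_window t).1)
      (fun t => (deg3A_window t).2)
    have := (Submodule.finrank_mono hspan).trans hIn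
    omega
  · set InG : Submodule K (A2 × B23 × B23 → K) :=
      ⨆ i ∈ Finset.range 23, inPart deg3B G₂ (-3 + i) with hInG
    have hspan : Submodule.span K (genSetB K S) ≤ InG := by
      refine Submodule.span_le.2 ?_
      rintro _ ⟨k, hk, b₀, rfl⟩
      rw [hS_def, Finset.mem_filter] at hk
      rw [rowFunB_eq]
      have h1 : MatMulTwo.mul120 K b₀ (wv K k) ∈ inPart deg3B G₂ (wdeg k + degB b₀) := by
        refine inPart_mono deg3B (le_iSup (fun b₀ : B23 => F.map (MatMulTwo.mul120 K b₀)) b₀) _ ?_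
        exact map_inPart_le deg2 deg3B (MatMulTwo.mul120 K b₀) (degB b₀) (mul120_mem_Vge K b₀)
          (projDeg_mul120 K b₀) F (wdeg k) (Submodule.mem_map_of_mem hk.2)
      have hwin := wdeg_add_degB_window k b₀
      obtain ⟨i, hi, hieq⟩ : ∃ i : ℕ, i ∈ Finset.range 23 ∧ (-3 : ℤ) + i = wdeg k + degB b₀ :=
        ⟨(wdeg k + degB b₀ + 3).toNat, by rw [Finset.mem_range]; omega, by omega⟩
      rw [← hieq] at h1
      exact (le_iSup₂ (f := fun i (_ : i ∈ Finset.range 23) => inPart deg3B G₂ (-3 + i)) i hi) h1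
    have hIn := finrank_biSup_inPart_le deg3B G₂ (-3) 23 (fun t => (deg3B_window t).1)
      (fun t => (deg3B_window t).2)
    have := (Submodule.finrank_mono hspan).trans hIn
    omega

/-- **`R̲(⟨2,2,3⟩) = 10` over EVERY field of characteristic `0`** (CHL 2023, Thm. 1.3, stated there
over `ℂ`; the lower bound `ten_le_algBorderRank_matMulTensor_223` is proved for any such field, and
the Bini–Capovani–Romani–Lotti upper bound `BCRL1979_algBorderRank_matMulTensor_223_le` over any
commutative ring), for the algebraic border rank over `K[ε]`.
[cite: ConnerHarperLandsberg2023, Thm. 1.3] [cite: BiniCapovaniRomaniLotti1979, main result] -/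
theorem algBorderRank_matMulTensor_223 : algBorderRank (matMulTensor K 2 2 3) = 10 :=
  le_antisymm (BCRL1979_algBorderRank_matMulTensor_223_le K)
    (ten_le_algBorderRank_matMulTensor_223 K)

end Main

end MatMul223

/-- **Conner–Harper–Landsberg 2023, Thm. 1.3: `R̲(M_⟨223⟩) = 10`** — the named fact
`ConnerHarperLandsberg2023_thm_1_3` (`BorderRankMatMulSmall.lean`), DISCHARGED for the tree's
algebraic border rank over `ℂ[ε]` (lower half: `MatMul223.ten_le_algBorderRank_matMulTensor_223`,
torus-fixed border apolarity with a kernel-checked certificate; upper half: Bini et al. 1979, in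
the tree). [cite: ConnerHarperLandsberg2023, Thm. 1.3] -/
theorem ConnerHarperLandsberg2023_thm_1_3_holds : ConnerHarperLandsberg2023_thm_1_3 :=
  ConnerHarperLandsberg2023_thm_1_3_iff_lower.2 (MatMul223.ten_le_algBorderRank_matMulTensor_223 ℂ)

end Literature.Computability.AlgebraicComplexity

end
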